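import Summits.Ventures.LatticeQCDFlow.Scoring.PooledESS
import Summits.Ventures.LatticeQCDFlow.Exactness.Phi4FlowSamplerErgodic
import HarnessLib

/-!
# The importance-sampling ESS of a flow from its weight bound: `ESS/N ≥ 1/W`

HONEST FRAMING: exact (Metropolis-corrected) sampling algorithms for lattice gauge theory;
figures of merit are autocorrelation/cost numbers at stated couplings and volumes; no
continuum-physics claim.  (SCALAR calibration rung S0-A: not a gauge result.)

Venture `LatticeQCDFlow` (cell pub-lqcd), sub-topic `Scoring`; FANOUT row 2 (`s0-phi4`, FLOW arm:
the reweighting / ESS column of the leaderboard).  NEW WORK of the cell (elementary); nothing is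
cited as a fact.  Printed counterparts, named only: Kong–Liu–Wong 1994 / Liu 1996 (`ESS = N/E_q[w̄²]`),
Albergo–Kanwar–Shanahan 2019 §II.C.

`Exactness/FlowSamplerAutocorrelation.lean` (row 2) bounds the CHAIN figure of merit from the
normalised weight bound `W = sup Z⁻¹e^{−S}/q̃`: `τ_int ≤ W − ½`, `n_eff ≥ N/(2W − 1)`.  This file
records the (easier) companion for the REWEIGHTING figure of merit, in both the sample and the
population form:

* `sum_sq_le_mul_sum` / **`kishESS_ge_sum_div`** — for a finite sample of weights `0 ≤ wᵢ ≤ M`: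
  `Σ wᵢ² ≤ M Σ wᵢ`, hence Kish's `(Σw)²/Σw² ≥ (Σ w)/M` (`Scoring.kishESS` of `PooledESS.lean`); with
  normalised weights (`Σ w̄ ≈ N`) this reads `ESS ≳ N/W`.
* `integral_sq_le_mul_integral` / **`essFrac_ge_inv`** — population form: for a probability law
  `q` and a weight `0 ≤ w ≤ M` with `∫ w dq = 1`: `∫ w² dq ≤ M`, i.e. the ESS fraction
  `(∫ w)²/∫ w² ≥ 1/M`.
* **`phi4Flow_essFrac_ge`** — the lattice φ⁴ flow: model density `q̃ > 0` with `∫ q̃ = 1`,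
  `e^{−S} ≤ W·Z·q̃` (`λ > 0`, any real `J`): the normalised weight `w̄ = e^{−S}/(Z q̃)` has
  `∫ w̄ q̃ dφ = 1` and `∫ w̄² q̃ dφ ≤ W` — reweighting ESS fraction `≥ 1/W`, the same `W` that
  controls mixing (`Phi4FlowSamplerErgodic.lean`) and `τ_int` (`FlowSamplerAutocorrelation.lean`).
NOT CLAIMED: anything about the per-sector ESS, or the value of `W` for a trained network.
-/

namespace Summit.Ventures.LatticeQCDFlow.Scoring

open Finset MeasureTheory Filter

/-! ## Sample form -/

section Sample

variable {ι : Type*}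

/-- `Σ wᵢ² ≤ M Σ wᵢ` for weights in `[0, M]`. -/
theorem sum_sq_le_mul_sum (s : Finset ι) {w : ι → ℝ} {M : ℝ} (h0 : ∀ i ∈ s, 0 ≤ w i)
    (hle : ∀ i ∈ s, w i ≤ M) : ∑ i ∈ s, w i ^ 2 ≤ M * ∑ i ∈ s, w i := by
  rw [mul_sum]
  exact sum_le_sum fun i hi => by
    rw [sq]
    exact mul_le_mul_of_nonneg_right (hle i hi) (h0 i hi)

/-- **Kish ESS from a weight bound (sample form)**: weights in `[0, M]`, `M > 0`, give
`(Σ w)/M ≤ (Σ w)²/Σ w²`. -/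
theorem kishESS_ge_sum_div (s : Finset ι) {w : ι → ℝ} {M : ℝ} (hM : 0 < M)
    (h0 : ∀ i ∈ s, 0 ≤ w i) (hle : ∀ i ∈ s, w i ≤ M) :
    (∑ i ∈ s, w i) / M ≤ kishESS s w := by
  unfold kishESS
  have hS0 : 0 ≤ ∑ i ∈ s, w i := sum_nonneg h0
  have hQ0 : 0 ≤ ∑ i ∈ s, w i ^ 2 := sum_nonneg fun i _ => sq_nonneg _
  have hQ := sum_sq_le_mul_sum s h0 hle
  rcases eq_or_lt_of_le hQ0 with hQz | hQpos
  · -- all weights vanish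
    have hall : ∀ i ∈ s, w i = 0 := fun i hi => by
      have h := (sum_eq_zero_iff_of_nonneg fun j _ => sq_nonneg (w j)).1 hQz.symm i hi
      exact pow_eq_zero_iff (n := 2) (by norm_num) |>.1 h
    rw [sum_congr rfl hall, sum_const_zero, zero_div]
    exact div_nonneg (sq_nonneg _) hQ0
  · rw [div_le_div_iff₀ hM hQpos, sq]
    calc (∑ i ∈ s, w i) * ∑ i ∈ s, w i ^ 2 ≤ (∑ i ∈ s, w i) * (M * ∑ i ∈ s, w i) :=
          mul_le_mul_of_nonneg_left hQ hS0
      _ = (∑ i ∈ s, w i) * (∑ i ∈ s, w i) * M := by ring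

end Sample

/-! ## Population form -/

section Population

variable {X : Type*} [MeasurableSpace X] {q : Measure X} {w : X → ℝ}

/-- `∫ w² dq ≤ M ∫ w dq` for a weight `0 ≤ w ≤ M` with `w` integrable. -/
theorem integral_sq_le_mul_integral (hwm : Measurable w) (h0 : ∀ x, 0 ≤ w x) {M : ℝ}
    (hle : ∀ x, w x ≤ M) (hwi : Integrable w q) :
    ∫ x, w x ^ 2 ∂q ≤ M * ∫ x, w x ∂q := by
  have hw2 : Integrable (fun x => w x ^ 2) q := by
    refine Integrable.mono' (hwi.const_mul M) (hwm.pow_const 2).aestronglyMeasurable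
      (Eventually.of_forall fun x => ?_)
    rw [Real.norm_eq_abs, abs_of_nonneg (sq_nonneg _), sq]
    exact mul_le_mul_of_nonneg_right (hle x) (h0 x)
  rw [← integral_const_mul]
  exact integral_mono hw2 (hwi.const_mul M) fun x => by
    dsimp only
    rw [sq]
    exact mul_le_mul_of_nonneg_right (hle x) (h0 x)

/-- **ESS fraction from a weight bound (population form)**: `q` a probability law, `0 ≤ w ≤ M`,
`∫ w dq = 1` (normalised weights) ⇒ `∫ w² dq ≤ M`, i.e. `ESS/N = 1/∫ w² dq ≥ 1/M`. -/
theorem essFrac_ge_inv [IsProbabilityMeasure q] (hwm : Measurable w) (h0 : ∀ x, 0 ≤ w x)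
    {M : ℝ} (hle : ∀ x, w x ≤ M) (hwi : Integrable w q) (h1 : ∫ x, w x ∂q = 1) :
    ∫ x, w x ^ 2 ∂q ≤ M ∧ 1 / M ≤ 1 / ∫ x, w x ^ 2 ∂q := by
  have h := integral_sq_le_mul_integral hwm h0 hle hwi
  rw [h1, mul_one] at h
  refine ⟨h, ?_⟩
  -- `∫ w² > 0`: by Jensen `(∫ w)² ≤ ∫ w²` on a probability space, and `∫ w = 1`
  have hpos : 0 < ∫ x, w x ^ 2 ∂q := by
    have hvar : 0 ≤ ∫ x, (w x - 1) ^ 2 ∂q := integral_nonneg fun x => sq_nonneg _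
    have hw2 : Integrable (fun x => w x ^ 2) q := by
      refine Integrable.mono' (hwi.const_mul M) (hwm.pow_const 2).aestronglyMeasurable
        (Eventually.of_forall fun x => ?_)
      rw [Real.norm_eq_abs, abs_of_nonneg (sq_nonneg _), sq]
      exact mul_le_mul_of_nonneg_right (hle x) (h0 x)
    have e : ∫ x, (w x - 1) ^ 2 ∂q = (∫ x, w x ^ 2 ∂q) - 1 := by
      have e1 : ∀ x, (w x - 1) ^ 2 = w x ^ 2 - 2 * w x + 1 := fun x => by ring
      simp_rw [e1]
      have i12 : Integrable (fun x => w x ^ 2 - 2 * w x) q := hw2.sub (hwi.const_mul 2)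
      rw [integral_add i12 (integrable_const _), integral_sub hw2 (hwi.const_mul 2),
        integral_const_mul, h1, integral_const, probReal_univ]
      simp only [smul_eq_mul, mul_one]
      ring
    linarith
  exact one_div_le_one_div_of_le hpos h

end Population

/-! ## The lattice φ⁴ flow -/

section Lattice

open Summit.Ventures.LatticeQCDFlow.Exactness

variable {n : ℕ}

/-- **REWEIGHTING ESS OF THE φ⁴ FLOW FROM THE WEIGHT BOUND.**  `λ > 0`, any real `J`; model
density `q̃ > 0` measurable with `∫ q̃ = 1`; weight bound `e^{−S} ≤ W·Z·q̃`.  Then the normalised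
importance weight `w̄ = e^{−S}/(Z q̃)` satisfies `∫ w̄ dq̃ = 1` and `∫ w̄² dq̃ ≤ W`: the population
ESS fraction `1/E_q̃[w̄²]` is at least `1/W`. -/
theorem phi4Flow_essFrac_ge {lam : ℝ} (hlam : 0 < lam) (J : Fin (n + 1) → Fin (n + 1) → ℝ)
    {q : (Fin (n + 1) → ℝ) → ℝ} (hq0 : ∀ φ, 0 < q φ) (hqm : Measurable q) (hqi : Integrable q)
    (hq1 : ∫ φ, q φ = 1) {W : ℝ} (hW : ∀ φ, gibbsWeight J lam φ ≤ W * gibbsZ J lam * q φ) :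
    ∫ φ, (gibbsWeight J lam φ / (gibbsZ J lam * q φ)) ∂(flowModel q) = 1
      ∧ ∫ φ, (gibbsWeight J lam φ / (gibbsZ J lam * q φ)) ^ 2 ∂(flowModel q) ≤ W := by
  haveI := isProbabilityMeasure_flowModel hq0 hqi hq1
  have hZ := gibbsZ_pos hlam J
  set wbar : (Fin (n + 1) → ℝ) → ℝ := fun φ => gibbsWeight J lam φ / (gibbsZ J lam * q φ) with hwb
  have hwm : Measurable wbar :=
    (continuous_gibbsWeight J lam).measurable.div (measurable_const.mul hqm)
  have hw0 : ∀ φ, 0 ≤ wbar φ := fun φ =>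
    div_nonneg (gibbsWeight_pos J lam φ).le (mul_pos hZ (hq0 φ)).le
  have hwW : ∀ φ, wbar φ ≤ W := fun φ => by
    simp only [hwb]
    rw [div_le_iff₀ (mul_pos hZ (hq0 φ))]
    calc gibbsWeight J lam φ ≤ W * gibbsZ J lam * q φ := hW φ
      _ = W * (gibbsZ J lam * q φ) := by ring
  -- integrals against the model law are Lebesgue integrals with the density `q̃`
  have hint : ∀ f : (Fin (n + 1) → ℝ) → ℝ, ∫ φ, f φ ∂(flowModel q) = ∫ φ, q φ * f φ := by
    intro f
    rw [flowModel, integral_withDensity_eq_integral_toReal_smul hqm.ennreal_ofReal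
      (Eventually.of_forall fun _ => ENNReal.ofReal_lt_top)]
    refine integral_congr_ae (Eventually.of_forall fun φ => ?_)
    dsimp only
    rw [ENNReal.toReal_ofReal (hq0 φ).le, smul_eq_mul]
  have h1 : ∫ φ, wbar φ ∂(flowModel q) = 1 := by
    rw [hint]
    have e : ∀ φ, q φ * wbar φ = gibbsWeight J lam φ / gibbsZ J lam := fun φ => by
      simp only [hwb]
      have hq' : q φ ≠ 0 := (hq0 φ).ne'
      field_simp
    simp_rw [e]
    rw [integral_div]
    unfold gibbsZ
    exact div_self (by unfold gibbsZ at hZ; exact hZ.ne')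
  have hwi : Integrable wbar (flowModel q) := by
    refine Integrable.mono' (integrable_const W) hwm.aestronglyMeasurable
      (Eventually.of_forall fun φ => ?_)
    rw [Real.norm_eq_abs, abs_of_nonneg (hw0 φ)]
    exact hwW φ
  exact ⟨h1, (essFrac_ge_inv hwm hw0 hwW hwi h1).1⟩

end Lattice

end Summit.Ventures.LatticeQCDFlow.Scoring
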